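import Summits.NavierStokesRegularity.OSWSelfSimilar.SheetRVelocityWirtinger
import Summits.NavierStokesRegularity.OSWSelfSimilar.SheetREnergyClass
import Mathlib.MeasureTheory.Integral.Prod
import HarnessLib

/-!
# SHEET-ℝ frame, the endpoint sentence H∞ on the dense class: `𝒰φ(ξ) → 0` as `ξ → ±∞` for odd `φ ∈ C¹_c`, and the
# SHARP (E5) `𝒰`-bound there

HONEST FRAMING (cell ns-blowup GROUP B / zone Z3, case Z3-SR-CERT; 1-D MODEL certificate frame; not Euler/NS).

RULING (ej)(2) made «H∞ := ∀ δ ∈ E: 𝒰δ(ξ) = ∫₀^ξ Hδ → 0 as ξ → ±∞» the one sentence under which the (E5) `𝒰`-term takes PRICE-impl1's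
sharp constant (`SheetRVelocityWirtinger.integral_velocity_sq_le`: Dirichlet–Wirtinger) instead of the one-sided constant of record
(`…_four_mul`). This file proves H∞ and the sharp bound, fully composed, on the DENSE CLASS of odd `C¹` functions with compact support
(the class whose closure defines `E`; the closure passage belongs to the MODEL ASSEMBLY — per profile-refuter g4's letter T4 the
constant of record does not move on this file alone). For `φ` odd, `C¹`, `φ = 0` off `[−S, S]`:

* §2 Fubini: `∫₀^R Hφ = π⁻¹·∫_{t>0} [P(R − t) − P(R + t)]/t dt`, `P(y) := ∫₀^y φ` (even; the symmetric integrand is bounded by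
  `2‖φ′‖_∞` and vanishes for `t > R + S`);
* §3 `P ≡ P(S)` off `(−S, S)`, so for `R > S` the integrand lives on `(R − S, R + S)` and **`|∫₀^R Hφ| ≤ 4S·∫|φ| /(π(R − S))`**;
* §4 **`Tendsto (ξ ↦ ∫₀^ξ Hφ) atTop (𝓝 0)`** and `atBot` (`Hφ` is even) — H∞ on the class;
* §5 composition with `integral_velocity_sq_le_of_weightedSq_eq` and the tree's class facts (`Hφ` continuous:
  `SheetRWeakProfilePV.continuous_hilbertTransform_of_contDiff`; `‖Hφ‖_w = ‖φ‖_w` and `w(Hφ)² ∈ L¹`: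
  `SheetREnergyClass.weightedSq_hilbertTransform_of_primitive`): **`∫ (𝒰φ)²·2L/(L²+ξ²) dξ ≤ (2L)⁻¹·∫(L²+ξ²)φ²`** with standard axioms and
  no residual hypothesis — the sharp (E5) sentence on the dense class.

Pure calculus/measure theory; no definition, no named fact, nothing asserted about any profile. MODEL frame bookkeeping only.
-/

noncomputable section

namespace Summit.NavierStokesRegularity.OSWSelfSimilar
namespace SheetRVelocityEndpoint

open _root_.MeasureTheory _root_.Set _root_.Filter _root_.Real intervalIntegral
open scoped Real Topology
open Literature.Analysis.Fourier

/-! ### §1 The primitive `P = ∫₀ φ` of an odd function vanishing off `[−S, S]` -/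

/-- For odd `φ`: `∫₀^{−t} φ = ∫₀^t φ` (`P` is even). [folklore] -/
theorem primitive_neg_of_odd {φ : ℝ → ℝ} (hodd : ∀ y, φ (-y) = -φ y) (t : ℝ) :
    ∫ x in (0:ℝ)..(-t), φ x = ∫ x in (0:ℝ)..t, φ x := by
  have h := intervalIntegral.integral_comp_neg (a := 0) (b := t) (f := φ)
  simp only [neg_zero] at h
  -- `h : ∫ x in 0..t, φ (-x) = ∫ x in -t..0, φ x`
  have h2 : ∫ x in (0:ℝ)..t, φ (-x) = -∫ x in (0:ℝ)..t, φ x := by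
    rw [← intervalIntegral.integral_neg]
    exact intervalIntegral.integral_congr fun x _ => hodd x
  rw [intervalIntegral.integral_symm (-t) 0, ← h, h2, neg_neg]

/-- If `φ = 0` on `{|y| ≥ S}` (`0 ≤ S`) then `∫₀^y φ = ∫₀^S φ` for every `y ≥ S`. [folklore] -/
theorem primitive_eq_of_ge {φ : ℝ → ℝ} (hc : Continuous φ) {S : ℝ} (hS : 0 ≤ S) (hsupp : ∀ y, S ≤ |y| → φ y = 0)
    {y : ℝ} (hy : S ≤ y) : ∫ x in (0:ℝ)..y, φ x = ∫ x in (0:ℝ)..S, φ x := by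
  have h : (∫ x in (0:ℝ)..S, φ x) + ∫ x in S..y, φ x = ∫ x in (0:ℝ)..y, φ x :=
    intervalIntegral.integral_add_adjacent_intervals (hc.intervalIntegrable 0 S) (hc.intervalIntegrable S y)
  rw [← h]
  have hz : ∫ x in S..y, φ x = ∫ x in S..y, (0:ℝ) := by
    refine intervalIntegral.integral_congr fun x hx => ?_
    rw [uIcc_of_le hy] at hx
    exact hsupp x (by rw [abs_of_nonneg (le_trans hS hx.1)]; exact hx.1)
  rw [hz, intervalIntegral.integral_zero, add_zero]

/-- … and, by evenness, also for `y ≤ −S` when `φ` is odd. [folklore] -/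
theorem primitive_eq_of_le_neg {φ : ℝ → ℝ} (hc : Continuous φ) (hodd : ∀ y, φ (-y) = -φ y) {S : ℝ} (hS : 0 ≤ S)
    (hsupp : ∀ y, S ≤ |y| → φ y = 0) {y : ℝ} (hy : y ≤ -S) : ∫ x in (0:ℝ)..y, φ x = ∫ x in (0:ℝ)..S, φ x := by
  have h := primitive_neg_of_odd hodd (-y)
  rw [neg_neg] at h
  rw [h]
  exact primitive_eq_of_ge hc hS hsupp (by linarith)

/-- `|∫₀^y φ| ≤ ∫_ℝ |φ|` for integrable `φ`. [folklore] -/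
theorem abs_primitive_le {φ : ℝ → ℝ} (hφi : Integrable φ) (y : ℝ) :
    |∫ x in (0:ℝ)..y, φ x| ≤ ∫ x, |φ x| := by
  rcases le_or_gt 0 y with hy | hy
  · rw [intervalIntegral.integral_of_le hy]
    calc |∫ x in Ioc 0 y, φ x| ≤ ∫ x in Ioc 0 y, |φ x| := abs_integral_le_integral_abs
      _ ≤ ∫ x, |φ x| := setIntegral_le_integral hφi.abs (Eventually.of_forall fun x => abs_nonneg _)
  · rw [intervalIntegral.integral_symm, intervalIntegral.integral_of_le hy.le, abs_neg]
    calc |∫ x in Ioc y 0, φ x| ≤ ∫ x in Ioc y 0, |φ x| := abs_integral_le_integral_abs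
      _ ≤ ∫ x, |φ x| := setIntegral_le_integral hφi.abs (Eventually.of_forall fun x => abs_nonneg _)

/-! ### §2 Fubini: `∫₀^R Hφ = π⁻¹ ∫_{t>0} [P(R−t) − P(R+t)]/t dt` -/

/-- The inner `x`-integral: `∫₀^R (φ(x−t) − φ(x+t)) dx = P(R−t) − P(R+t)` for odd `φ` (`P(−t) = P(t)` cancels). [folklore] -/
theorem integral_sub_shift_eq {φ : ℝ → ℝ} (hc : Continuous φ) (hodd : ∀ y, φ (-y) = -φ y) (R t : ℝ) :
    ∫ x in (0:ℝ)..R, (φ (x - t) - φ (x + t)) =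
      (∫ x in (0:ℝ)..(R - t), φ x) - ∫ x in (0:ℝ)..(R + t), φ x := by
  have i1 : IntervalIntegrable (fun x => φ (x - t)) volume 0 R :=
    Continuous.intervalIntegrable (by fun_prop) 0 R
  have i2 : IntervalIntegrable (fun x => φ (x + t)) volume 0 R :=
    Continuous.intervalIntegrable (by fun_prop) 0 R
  rw [intervalIntegral.integral_sub i1 i2,
    intervalIntegral.integral_comp_sub_right φ t, intervalIntegral.integral_comp_add_right φ t, zero_sub, zero_add]
  have h1 : ∫ x in (-t)..(R - t), φ x = (∫ x in (0:ℝ)..(R - t), φ x) - ∫ x in (0:ℝ)..(-t), φ x :=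
    (intervalIntegral.integral_interval_sub_left (hc.intervalIntegrable _ _) (hc.intervalIntegrable _ _)).symm
  have h2 : ∫ x in t..(R + t), φ x = (∫ x in (0:ℝ)..(R + t), φ x) - ∫ x in (0:ℝ)..t, φ x :=
    (intervalIntegral.integral_interval_sub_left (hc.intervalIntegrable _ _) (hc.intervalIntegrable _ _)).symm
  rw [h1, h2, primitive_neg_of_odd hodd t]
  ring

/-- Compact support from the support bound (helper). [folklore] -/
theorem hasCompactSupport_of_bound {φ : ℝ → ℝ} {S : ℝ} (hsupp : ∀ y, S ≤ |y| → φ y = 0) : HasCompactSupport φ := by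
  refine HasCompactSupport.intro (isCompact_Icc : IsCompact (Icc (-S) S)) fun x hx => hsupp x ?_
  simp only [mem_Icc, not_and_or, not_le] at hx
  rcases hx with h | h
  · linarith [neg_le_abs x]
  · linarith [le_abs_self x]

/-- **Fubini representation**: for odd `φ ∈ C¹` vanishing off `[−S, S]` (`S > 0`) and `R > 0`,
`∫₀^R Hφ = π⁻¹·∫_{t>0} (P(R−t) − P(R+t))/t dt`, `P = ∫₀φ`. [folklore] -/
theorem integral_hilbertTransform_eq {φ : ℝ → ℝ} (hφ : ContDiff ℝ 1 φ) (hodd : ∀ y, φ (-y) = -φ y) {S : ℝ} (hS : 0 < S)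
    (hsupp : ∀ y, S ≤ |y| → φ y = 0) {R : ℝ} (hR : 0 < R) :
    ∫ x in (0:ℝ)..R, hilbertTransform φ x =
      π⁻¹ * ∫ t in Ioi (0:ℝ), ((∫ x in (0:ℝ)..(R - t), φ x) - ∫ x in (0:ℝ)..(R + t), φ x) / t := by
  have hc : Continuous φ := hφ.continuous
  have hd : Differentiable ℝ φ := hφ.differentiable one_ne_zero
  have hcs : HasCompactSupport φ := hasCompactSupport_of_bound hsupp
  -- bound on the derivative
  obtain ⟨D, hD⟩ : ∃ D, ∀ x, ‖deriv φ x‖ ≤ D :=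
    (hφ.continuous_deriv le_rfl).bounded_above_of_compact_support hcs.deriv
  have hD0 : 0 ≤ D := le_trans (norm_nonneg _) (hD 0)
  set K : ℝ → ℝ → ℝ := fun x t => (φ (x - t) - φ (x + t)) / t with hK
  -- pointwise bound `|K x t| ≤ 2D` for `t > 0`
  have hKbd : ∀ x t, 0 < t → ‖K x t‖ ≤ 2 * D := by
    intro x t ht
    have hmvt : ‖φ (x + t) - φ (x - t)‖ ≤ D * ‖x + t - (x - t)‖ :=
      Convex.norm_image_sub_le_of_norm_deriv_le (fun y _ => hd y) (fun y _ => hD y) convex_univ (mem_univ _) (mem_univ _)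
    rw [show x + t - (x - t) = 2 * t by ring, Real.norm_eq_abs, Real.norm_eq_abs,
      abs_of_pos (by linarith : (0:ℝ) < 2 * t)] at hmvt
    rw [hK, Real.norm_eq_abs, abs_div, abs_of_pos ht, div_le_iff₀ ht, abs_sub_comm]
    linarith
  -- `K x t = 0` for `x ∈ (0, R]`, `t > R + S`
  have hKzero : ∀ x ∈ Ioc (0:ℝ) R, ∀ t, R + S < t → K x t = 0 := by
    intro x hx t ht
    have h1 : φ (x - t) = 0 := hsupp _ (by rw [abs_of_neg (by linarith [hx.2])]; linarith [hx.2])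
    have h2 : φ (x + t) = 0 := hsupp _ (by rw [abs_of_pos (by linarith [hx.1])]; linarith [hx.1])
    simp [hK, h1, h2]
  -- continuity of `uncurry K` on `{t > 0}`
  have hKc : ContinuousOn (Function.uncurry K) (univ ×ˢ Ioi (0:ℝ)) := by
    have hnum : Continuous fun p : ℝ × ℝ => φ (p.1 - p.2) - φ (p.1 + p.2) := by fun_prop
    refine (hnum.continuousOn.div continuous_snd.continuousOn fun p hp => ?_)
    exact (ne_of_gt (show (0:ℝ) < p.2 from hp.2))
  -- integrability on the product
  set A : Set (ℝ × ℝ) := Ioc (0:ℝ) R ×ˢ Ioc (0:ℝ) (R + S) with hA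
  set B : Set (ℝ × ℝ) := Ioc (0:ℝ) R ×ˢ Ioi (R + S) with hB
  have hAsub : A ⊆ univ ×ˢ Ioi (0:ℝ) := fun p hp => ⟨mem_univ _, hp.2.1⟩
  have hBsub : B ⊆ univ ×ˢ Ioi (0:ℝ) := fun p hp =>
    ⟨mem_univ _, show (0:ℝ) < p.2 from lt_trans (show (0:ℝ) < R + S by linarith) hp.2⟩
  have hAmeas : MeasurableSet A := measurableSet_Ioc.prod measurableSet_Ioc
  have hBmeas : MeasurableSet B := measurableSet_Ioc.prod measurableSet_Ioi
  have hIA : IntegrableOn (Function.uncurry K) A (volume.prod volume) := by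
    have hfin : (volume.prod volume) A ≠ ⊤ := by
      rw [hA, Measure.prod_prod]
      exact ENNReal.mul_ne_top measure_Ioc_lt_top.ne measure_Ioc_lt_top.ne
    exact Integrable.mono' (integrableOn_const (C := 2 * D) hfin) ((hKc.mono hAsub).aestronglyMeasurable hAmeas)
      (ae_restrict_of_forall_mem hAmeas fun p hp => hKbd p.1 p.2 hp.2.1)
  have hIB : IntegrableOn (Function.uncurry K) B (volume.prod volume) :=
    integrableOn_zero.congr_fun (fun p hp => (hKzero p.1 hp.1 p.2 hp.2).symm) hBmeas
  have hset : Ioc (0:ℝ) R ×ˢ Ioi (0:ℝ) = A ∪ B := by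
    rw [hA, hB, ← prod_union, Ioc_union_Ioi_eq_Ioi (by linarith : (0:ℝ) ≤ R + S)]
  have hint : Integrable (Function.uncurry K) ((volume.restrict (Ioc (0:ℝ) R)).prod (volume.restrict (Ioi (0:ℝ)))) := by
    rw [Measure.prod_restrict, hset]
    exact hIA.union hIB
  -- Fubini
  have hswap := MeasureTheory.integral_integral_swap hint
  -- assemble the left-hand side
  have hL : ∫ x in (0:ℝ)..R, hilbertTransform φ x = π⁻¹ * ∫ x in Ioc (0:ℝ) R, ∫ t in Ioi (0:ℝ), K x t := by
    rw [intervalIntegral.integral_of_le hR.le, ← MeasureTheory.integral_const_mul]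
    rfl
  rw [hL, hswap]
  congr 1
  refine setIntegral_congr_fun measurableSet_Ioi fun t ht => ?_
  have ht0 : (0:ℝ) < t := ht
  simp only [hK]
  rw [MeasureTheory.integral_div, ← intervalIntegral.integral_of_le hR.le, integral_sub_shift_eq hc hodd R t]

/-! ### §3 The bound `|∫₀^R Hφ| ≤ 4S·∫|φ| /(π(R − S))` for `R > S` -/

/-- For `R > S` the `t`-integrand of §2 vanishes off `(R − S, R + S)` and is bounded by `2∫|φ|/(R − S)` there, whence
**`|∫₀^R Hφ| ≤ π⁻¹·4S·(∫|φ|)/(R − S)`**. [folklore] -/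
theorem abs_integral_hilbertTransform_le {φ : ℝ → ℝ} (hφ : ContDiff ℝ 1 φ) (hodd : ∀ y, φ (-y) = -φ y) {S : ℝ} (hS : 0 < S)
    (hsupp : ∀ y, S ≤ |y| → φ y = 0) {R : ℝ} (hR : S < R) :
    |∫ x in (0:ℝ)..R, hilbertTransform φ x| ≤ π⁻¹ * (4 * S * (∫ x, |φ x|) / (R - S)) := by
  have hc : Continuous φ := hφ.continuous
  have hφi : Integrable φ := hc.integrable_of_hasCompactSupport (hasCompactSupport_of_bound hsupp)
  have hRS : 0 < R - S := by linarith
  rw [integral_hilbertTransform_eq hφ hodd hS hsupp (lt_trans hS hR), abs_mul, abs_of_pos (by positivity : (0:ℝ) < π⁻¹)]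
  refine mul_le_mul_of_nonneg_left ?_ (by positivity)
  set P : ℝ → ℝ := fun y => ∫ x in (0:ℝ)..y, φ x with hP
  set m : ℝ := P S with hm
  set M₁ : ℝ := ∫ x, |φ x| with hM₁
  have hPge : ∀ y, S ≤ y → P y = m := fun y hy => primitive_eq_of_ge hc hS.le hsupp hy
  have hPle : ∀ y, y ≤ -S → P y = m := fun y hy => primitive_eq_of_le_neg hc hodd hS.le hsupp hy
  have hPbd : ∀ y, |P y| ≤ M₁ := fun y => abs_primitive_le hφi y
  set J : ℝ → ℝ := fun t => (P (R - t) - P (R + t)) / t with hJ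
  -- the integrand vanishes off `(R − S, R + S)`
  have hzero : ∀ t ∈ Ioi (0:ℝ) \ Ioo (R - S) (R + S), J t = 0 := by
    intro t ht
    have ht0 : (0:ℝ) < t := ht.1
    have hRt : P (R + t) = m := hPge _ (by linarith)
    have hcase : t ≤ R - S ∨ R + S ≤ t := by
      rcases le_or_gt t (R - S) with h | h
      · exact Or.inl h
      · rcases le_or_gt (R + S) t with h' | h'
        · exact Or.inr h'
        · exact absurd ⟨h, h'⟩ ht.2
    have hRt' : P (R - t) = m := by
      rcases hcase with h | h
      · exact hPge _ (by linarith)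
      · exact hPle _ (by linarith)
    simp [hJ, hRt, hRt']
  have hsub : Ioo (R - S) (R + S) ⊆ Ioi (0:ℝ) := fun t ht => lt_trans hRS ht.1
  have heq : ∫ t in Ioi (0:ℝ), J t = ∫ t in Ioo (R - S) (R + S), J t :=
    setIntegral_eq_of_subset_of_forall_sdiff_eq_zero measurableSet_Ioi hsub hzero
  -- bound on the window
  have hbd : ∀ t ∈ Ioo (R - S) (R + S), ‖J t‖ ≤ 2 * M₁ / (R - S) := by
    intro t ht
    have ht0 : 0 < t := lt_trans hRS ht.1
    rw [Real.norm_eq_abs, hJ]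
    simp only
    rw [abs_div, abs_of_pos ht0, div_le_div_iff₀ ht0 hRS]
    have h1 : |P (R - t) - P (R + t)| ≤ 2 * M₁ := by
      calc |P (R - t) - P (R + t)| ≤ |P (R - t)| + |P (R + t)| := abs_sub _ _
        _ ≤ M₁ + M₁ := add_le_add (hPbd _) (hPbd _)
        _ = 2 * M₁ := by ring
    have hM0 : 0 ≤ M₁ := integral_nonneg fun x => abs_nonneg _
    calc |P (R - t) - P (R + t)| * (R - S) ≤ 2 * M₁ * (R - S) := mul_le_mul_of_nonneg_right h1 hRS.le
      _ ≤ 2 * M₁ * t := mul_le_mul_of_nonneg_left ht.1.le (by positivity)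
  have hfinal := norm_setIntegral_le_of_norm_le_const (measure_Ioo_lt_top (μ := volume)) hbd
  rw [Real.volume_real_Ioo_of_le (by linarith : R - S ≤ R + S), Real.norm_eq_abs] at hfinal
  show |∫ t in Ioi (0:ℝ), J t| ≤ 4 * S * M₁ / (R - S)
  rw [heq]
  calc |∫ t in Ioo (R - S) (R + S), J t| ≤ 2 * M₁ / (R - S) * (R + S - (R - S)) := hfinal
    _ = 4 * S * M₁ / (R - S) := by field_simp; ring

/-! ### §4 H∞ on the dense class: `∫₀^ξ Hφ → 0` as `ξ → ±∞` -/

/-- **H∞ for odd `φ ∈ C¹_c`**: `Tendsto (ξ ↦ ∫₀^ξ Hφ) atTop (𝓝 0)`. [folklore] -/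
theorem tendsto_velocity_atTop {φ : ℝ → ℝ} (hφ : ContDiff ℝ 1 φ) (hodd : ∀ y, φ (-y) = -φ y)
    (hcs : HasCompactSupport φ) :
    Tendsto (fun ξ : ℝ => ∫ x in (0:ℝ)..ξ, hilbertTransform φ x) atTop (𝓝 0) := by
  -- a support bound `S > 0`
  obtain ⟨r, hr⟩ := (Metric.isBounded_iff_subset_closedBall (0:ℝ)).1 hcs.isCompact.isBounded
  set S : ℝ := max r 0 + 1 with hSdef
  have hS : 0 < S := by rw [hSdef]; linarith [le_max_right r 0]
  have hsupp : ∀ y, S ≤ |y| → φ y = 0 := by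
    intro y hy
    apply image_eq_zero_of_notMem_tsupport
    intro hmem
    have := hr hmem
    rw [Metric.mem_closedBall, dist_zero_right, Real.norm_eq_abs] at this
    linarith [le_max_left r 0]
  set C : ℝ := π⁻¹ * (4 * S * ∫ x, |φ x|) with hC
  have hbound : ∀ᶠ R in atTop, ‖∫ x in (0:ℝ)..R, hilbertTransform φ x‖ ≤ C / (R - S) := by
    filter_upwards [eventually_gt_atTop S] with R hR
    rw [Real.norm_eq_abs]
    refine (abs_integral_hilbertTransform_le hφ hodd hS hsupp hR).trans (le_of_eq ?_)
    rw [hC]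
    ring
  have hlim : Tendsto (fun R : ℝ => C / (R - S)) atTop (𝓝 0) :=
    tendsto_const_nhds.div_atTop (tendsto_atTop_add_const_right _ _ tendsto_id)
  exact squeeze_zero_norm' hbound hlim

/-- For odd `φ` the function `Hφ` is even, so `∫₀^{−ξ} Hφ = −∫₀^ξ Hφ`. [folklore] -/
theorem velocity_neg {φ : ℝ → ℝ} (hodd : ∀ y, φ (-y) = -φ y) (ξ : ℝ) :
    ∫ x in (0:ℝ)..(-ξ), hilbertTransform φ x = -∫ x in (0:ℝ)..ξ, hilbertTransform φ x := by
  have h := intervalIntegral.integral_comp_neg (a := 0) (b := ξ) (f := hilbertTransform φ)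
  simp only [neg_zero] at h
  have h2 : ∫ x in (0:ℝ)..ξ, hilbertTransform φ (-x) = ∫ x in (0:ℝ)..ξ, hilbertTransform φ x :=
    intervalIntegral.integral_congr fun x _ => hilbertTransform_neg_arg_of_odd hodd x
  rw [intervalIntegral.integral_symm (-ξ) 0, ← h, h2]

/-- **H∞, both ends**: also `Tendsto (ξ ↦ ∫₀^ξ Hφ) atBot (𝓝 0)`. [folklore] -/
theorem tendsto_velocity_atBot {φ : ℝ → ℝ} (hφ : ContDiff ℝ 1 φ) (hodd : ∀ y, φ (-y) = -φ y)
    (hcs : HasCompactSupport φ) :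
    Tendsto (fun ξ : ℝ => ∫ x in (0:ℝ)..ξ, hilbertTransform φ x) atBot (𝓝 0) := by
  have h := (tendsto_velocity_atTop hφ hodd hcs).comp tendsto_neg_atBot_atTop
  have h2 := h.neg
  rw [neg_zero] at h2
  refine h2.congr fun ξ => ?_
  simp only [Function.comp_def]
  rw [velocity_neg hodd ξ, neg_neg]

/-! ### §5 The sharp (E5) `𝒰`-bound on the dense class, fully composed -/

/-- **Sharp (E5) `𝒰`-bound on odd `C¹_c`** (`L > 0`): for `φ` odd, `C¹`, compactly supported,
`∫ (∫₀^ξ Hφ)²·2L/(L² + ξ²) dξ ≤ (2L)⁻¹·∫ (L² + ξ²)φ(ξ)² dξ` — i.e. `‖𝒰φ‖_{L²(dθ)} ≤ (2L)^{-1/2}‖φ‖_w`, PRICE-impl1's (E5)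
multiplier, with every hypothesis of `SheetRVelocityWirtinger.integral_velocity_sq_le_of_weightedSq_eq` discharged from class membership:
`Hφ` continuous (`continuous_hilbertTransform_of_contDiff`), `w(Hφ)² ∈ L¹` and `‖Hφ‖_w = ‖φ‖_w`
(`SheetREnergyClass.weightedSq_hilbertTransform_of_primitive`), and H∞ (§4). [folklore] -/
theorem integral_velocity_sq_le_of_contDiff {L : ℝ} (hL : 0 < L) {φ : ℝ → ℝ} (hφ : ContDiff ℝ 1 φ)
    (hodd : ∀ y, φ (-y) = -φ y) (hcs : HasCompactSupport φ) :
    ∫ ξ, (∫ x in (0:ℝ)..ξ, hilbertTransform φ x) ^ 2 * (2 * L / (L ^ 2 + ξ ^ 2)) ≤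
      (2 * L)⁻¹ * ∫ ξ, (L ^ 2 + ξ ^ 2) * φ ξ ^ 2 := by
  have hc : Continuous φ := hφ.continuous
  have hφi : Integrable φ := hc.integrable_of_hasCompactSupport hcs
  have hd : Differentiable ℝ φ := hφ.differentiable one_ne_zero
  have hdc : Continuous (deriv φ) := hφ.continuous_deriv le_rfl
  -- the primitive form `φ = φ 0 + ∫₀ φ′`
  have hprim : ∀ x, φ x = φ 0 + ∫ s in (0:ℝ)..x, deriv φ s := by
    intro x
    rw [intervalIntegral.integral_deriv_eq_sub (fun y _ => hd y) (hdc.intervalIntegrable 0 x)]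
    ring
  -- weighted integrability of `φ` and `φ′` (continuous, compact support)
  have h0 : Integrable fun y => (L ^ 2 + y ^ 2) * φ y ^ 2 := by
    refine Continuous.integrable_of_hasCompactSupport (by fun_prop) ?_
    exact (hcs.mul_left).mul_left
  have h1 : Integrable fun y => (L ^ 2 + y ^ 2) * deriv φ y ^ 2 := by
    refine Continuous.integrable_of_hasCompactSupport (by fun_prop) ?_
    exact (hcs.deriv.mul_left).mul_left
  obtain ⟨-, -, hwu, hiso⟩ :=
    SheetREnergyClass.weightedSq_hilbertTransform_of_primitive hL hprim hodd hdc.aestronglyMeasurable h0 h1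
  have hu : Continuous (hilbertTransform φ) := SheetRWeakProfilePV.continuous_hilbertTransform_of_contDiff hφ hφi
  have hU : ∀ ξ, HasDerivAt (fun ξ => ∫ x in (0:ℝ)..ξ, hilbertTransform φ x) (hilbertTransform φ ξ) ξ := fun ξ =>
    intervalIntegral.integral_hasDerivAt_right (hu.intervalIntegrable 0 ξ) (hu.stronglyMeasurableAtFilter _ _) hu.continuousAt
  exact SheetRVelocityWirtinger.integral_velocity_sq_le_of_weightedSq_eq hL hU hu (by simp) hwu
    (tendsto_velocity_atTop hφ hodd hcs) (tendsto_velocity_atBot hφ hodd hcs) hiso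

end SheetRVelocityEndpoint
end Summit.NavierStokesRegularity.OSWSelfSimilar
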